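import Literature.Computability.AlgebraicComplexity.GroupTheoreticMatMul
import Mathlib.LinearAlgebra.Finsupp.LinearCombination
import Mathlib.LinearAlgebra.LinearIndependent.Defs
import Mathlib.Algebra.BigOperators.Fin
import Mathlib.Data.ZMod.Basic
import Mathlib.Data.Fin.VecNotation
import Mathlib.Tactic.FinCases
import Mathlib.Tactic.Abel

/-!
# ω-census, STPP pattern `(2,2,2)^K`: the INVOLUTION-COSET reduction as a kernel criterion

HONEST FRAMING (pub-omega census; verbatim): lottery ticket; floor = certified bounds/negative ranges.
Census STRUCTURE bookkeeping (question Q7 of the pub-omega cell: onsets `n_k` / `N_k` of the pattern `(2,2,2)^k`, CKSU 2005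
Def. 5.1 = tree `IsSTPP`), NOT progress on `ω`: a `(2,2,2)^k` family certifies no matrix-multiplication bound of interest.
No search, no data: this is the exact reduction on which the cell's "icoset" class solvers rest (`icoset3.py`, `icoset3c.c`,
`icoset3q*`; note `HOME/pub-omega-eng2-g27/icoset/ICOSET-NOTE.md`, ENG2 gen 27, 2026-08-27), moved from a docstring into the kernel.

CLASS.  `V` a `ZMod 2`-module (elementary abelian 2-group), `H` any additive abelian group.  An involution-coset ("icoset") family
in `V × H` has all `3K` sets of the form `pair x s a = {(x, a), (x + s, a)}`, `s ≠ 0` — cosets of order-2 subgroups `⟨(s, 0)⟩` (ALL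
order-2 subgroups when `|H|` is odd; the k = 4, 5 onset witnesses and the order-80/120/144/152 hosts of the census are such).
DATA (`Icoset.Data`): offsets `xA xB xC`, involutions `sA sB sC : Fin K → V`, coordinates `a b c : Fin K → H`; every icoset
family of finsets comes from PROPER data (all `s ≠ 0`; `exists_data_of_isIcosetFamily`).

CRITERION (`Data.isSTPP_iff`).  The Def-5.1 word of the index triple `(i, j, k)` is `(s' − s) + (t' − t) + (u' − u)` with
`s' ∈ A i, s ∈ A k, t ∈ B i, t' ∈ B j, u ∈ C j, u' ∈ C k`; its `H`-component `h(i,j,k) = (a i − a k) + (b j − b i) + (c k − c j)`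
does not depend on the chosen elements, its `V`-component is `off(i,j,k) + Σ_r ε_r • slot_r`, `off = xA i + xA k + xB i + xB j +
xC j + xC k`, slots `(sA i, sA k, sB i, sB j, sC j, sC k)`, `ε ∈ 𝔽₂⁶` the choice vector (`word_eq`).  So, for proper data,
`IsSTPP` ⟺ (T) each `(sA t, sB t, sC t)` `𝔽₂`-independent ∧ (N) each non-constant `(i,j,k)` with `h = 0` is RESCUED:
`off ∉ span{slots}` (subset sums = span).  At 2-rank exactly three (each triple's involutions span `V`, e.g. `V = 𝔽₂³`;
`isSTPP_iff_of_span_eq_top`) two-equal-index triples are never rescued, so (D) `c − a`, `b − a`, `b − c` are INJECTIVE and (N)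
is needed for pairwise-distinct triples only — (T) ∧ (D) ∧ (Z) of `ICOSET-NOTE.md` (there in the normal form `a ≡ 0`).
NOT here: no census cell is decided (the class NONE/FOUND table stays engine-grade except FOUND rows already certified by `decide`,
`STPP222Pow7Icoset120.lean`, `STPP222Pow8Icoset144/152.lean`); no plane-slot bookkeeping; nothing for non-elementary 2-parts.
References: H. Cohn, R. Kleinberg, B. Szegedy, C. Umans, FOCS 2005 (arXiv:math/0511460), Def. 5.1.  Seat pub-omega-kernel-l4
(gen 19), 2026-08-27.
-/

namespace Summit.MatrixMultiplication.OmegaCensus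

open Finset Literature.Computability.AlgebraicComplexity

namespace Icoset

/-- The two elements of `𝔽₂`. [folklore] -/
theorem zmod2_cases (ε : ZMod 2) : ε = 0 ∨ ε = 1 := by revert ε; decide

/-- In `𝔽₂`, `ε + ε' = 0 ↔ ε = ε'`. [folklore] -/
theorem zmod2_add_eq_zero_iff (ε ε' : ZMod 2) : ε + ε' = 0 ↔ ε = ε' := by revert ε ε'; decide

section CharTwo
variable {V : Type*} [AddCommGroup V] [Module (ZMod 2) V]
/-- In a `ZMod 2`-module, `x + x = 0`. [folklore] -/
theorem add_self_eq_zero (x : V) : x + x = 0 := by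
  simpa [show (2 : ZMod 2) = 0 by decide] using (two_smul (ZMod 2) x).symm

/-- In a `ZMod 2`-module, subtraction is addition. [folklore] -/
theorem sub_eq_add' (x y : V) : x - y = x + y := by rw [sub_eq_add_neg, neg_eq_of_add_eq_zero_left (add_self_eq_zero y)]

/-- In a `ZMod 2`-module, `x + y = 0 ↔ x = y`. [folklore] -/
theorem add_eq_zero_iff_eq' (x y : V) : x + y = 0 ↔ x = y := by rw [← sub_eq_add', sub_eq_zero]

/-- A scalar of `𝔽₂` kills a NON-ZERO vector only if it is `0`. [folklore] -/
theorem smul_eq_zero_iff_left {s : V} (hs : s ≠ 0) (ε : ZMod 2) : ε • s = 0 ↔ ε = 0 := by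
  rcases zmod2_cases ε with rfl | rfl <;> simp [hs]
end CharTwo

section Pair
variable {V H : Type*} [AddCommGroup V] [DecidableEq V] [DecidableEq H]
/-- The coset `{(x, a), (x + s, a)}` of `⟨(s, 0)⟩ ≤ V × H` through `(x, a)` (a 2-set iff `s ≠ 0`).
[cite: CohnKleinbergSzegedyUmans2005, Def. 5.1] -/
def pair (x s : V) (a : H) : Finset (V × H) := {(x, a), (x + s, a)}

/-- A coset of a genuine involution has exactly two elements. [folklore] -/
theorem card_pair {x s : V} (a : H) (hs : s ≠ 0) : (pair x s a).card = 2 := by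
  rw [pair, card_insert_of_notMem, card_singleton]
  simp only [mem_singleton, Prod.mk.injEq, and_true]
  exact fun h => hs (by simpa using congrArg (fun v => v - x) h.symm)

variable [Module (ZMod 2) V]
/-- Membership in `pair x s a`: the elements are `(x + ε • s, a)`, `ε ∈ 𝔽₂`. [folklore] -/
theorem mem_pair_iff {x s : V} {a : H} {z : V × H} : z ∈ pair x s a ↔ ∃ ε : ZMod 2, z = (x + ε • s, a) := by
  simp only [pair, mem_insert, mem_singleton]
  refine ⟨?_, ?_⟩
  · rintro (rfl | rfl); exacts [⟨0, by simp⟩, ⟨1, by simp⟩]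
  · rintro ⟨ε, rfl⟩; rcases zmod2_cases ε with rfl | rfl <;> simp
end Pair

/-- The DATA of an involution-coset `(2,2,2)^K` family in `V × H`: per triple `t` and rôle `A/B/C` a `V`-offset `x`, an
involution `s ∈ V` and an `H`-coordinate. [cite: CohnKleinbergSzegedyUmans2005, Def. 5.1] -/
structure Data (V H : Type*) (K : ℕ) where
  /-- `V`-offsets of the `A`-sets. -/ xA : Fin K → V
  /-- `V`-offsets of the `B`-sets. -/ xB : Fin K → V
  /-- `V`-offsets of the `C`-sets. -/ xC : Fin K → V
  /-- involutions of the `A`-sets. -/ sA : Fin K → V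
  /-- involutions of the `B`-sets. -/ sB : Fin K → V
  /-- involutions of the `C`-sets. -/ sC : Fin K → V
  /-- `H`-coordinates of the `A`-sets. -/ a : Fin K → H
  /-- `H`-coordinates of the `B`-sets. -/ b : Fin K → H
  /-- `H`-coordinates of the `C`-sets. -/ c : Fin K → H

namespace Data

section VPart
variable {V H : Type*} [AddCommGroup V] [Module (ZMod 2) V] {K : ℕ} (d : Data V H K)
/-- PROPER data: every involution is non-zero (all `3K` sets are genuine 2-sets, `card_A/B/C`). [folklore] -/
def Proper : Prop := ∀ t, d.sA t ≠ 0 ∧ d.sB t ≠ 0 ∧ d.sC t ≠ 0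

/-- Constant part of the `V`-component of the word of `(i, j, k)`: `xA i + xA k + xB i + xB j + xC j + xC k`. [folklore] -/
def off (i j k : Fin K) : V := d.xA i + d.xA k + d.xB i + d.xB j + d.xC j + d.xC k

/-- The six involution SLOTS of `(i, j, k)` in the quantifier order of `IsSTPP` (`s' ∈ A i`, `s ∈ A k`, `t ∈ B i`,
`t' ∈ B j`, `u ∈ C j`, `u' ∈ C k`): `(sA i, sA k, sB i, sB j, sC j, sC k)`. [folklore] -/
def slots (i j k : Fin K) : Fin 6 → V := ![d.sA i, d.sA k, d.sB i, d.sB j, d.sC j, d.sC k]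

/-- The `𝔽₂`-combination of the six slots selected by `ε ∈ 𝔽₂⁶`, written out. [folklore] -/
def comb (i j k : Fin K) (ε : Fin 6 → ZMod 2) : V :=
  ε 0 • d.sA i + ε 1 • d.sA k + ε 2 • d.sB i + ε 3 • d.sB j + ε 4 • d.sC j + ε 5 • d.sC k

/-- `comb = Σ_r ε_r • slot_r`. [folklore] -/
theorem comb_eq_sum (i j k : Fin K) (ε : Fin 6 → ZMod 2) : d.comb i j k ε = ∑ r, ε r • d.slots i j k r := by
  simp [comb, slots, Fin.sum_univ_succ, add_assoc]

/-- The three involutions `(sA t, sB t, sC t)` of triple `t`. [folklore] -/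
def basis (t : Fin K) : Fin 3 → V := ![d.sA t, d.sB t, d.sC t]

/-- (T) in coordinates: `ε₁ • sA t + ε₂ • sB t + ε₃ • sC t = 0` only trivially. [folklore] -/
def Indep (t : Fin K) : Prop :=
  ∀ ε₁ ε₂ ε₃ : ZMod 2, ε₁ • d.sA t + ε₂ • d.sB t + ε₃ • d.sC t = 0 → ε₁ = 0 ∧ ε₂ = 0 ∧ ε₃ = 0

/-- (T) is linear independence of `(sA t, sB t, sC t)` over `𝔽₂`. [folklore] -/
theorem indep_iff_linearIndependent (t : Fin K) : d.Indep t ↔ LinearIndependent (ZMod 2) (d.basis t) := by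
  rw [Fintype.linearIndependent_iff]
  refine ⟨fun hI g hg i => ?_, fun hL ε₁ ε₂ ε₃ h0 => ?_⟩
  · have h3 := hI (g 0) (g 1) (g 2) (by simpa [basis, Fin.sum_univ_succ, add_assoc] using hg)
    fin_cases i; exacts [h3.1, h3.2.1, h3.2.2]
  · have := hL ![ε₁, ε₂, ε₃] (by simpa [basis, Fin.sum_univ_succ, add_assoc] using h0)
    exact ⟨this 0, this 1, this 2⟩

/-- `(i, j, k)` is RESCUED: `off(i,j,k) + Σ_r ε_r • slot_r ≠ 0` for every choice vector `ε ∈ 𝔽₂⁶`. [folklore] -/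
def Rescued (i j k : Fin K) : Prop := ∀ ε : Fin 6 → ZMod 2, d.off i j k + d.comb i j k ε ≠ 0

/-- RESCUED ⟺ `off(i,j,k) ∉ span_{𝔽₂} {sA i, sA k, sB i, sB j, sC j, sC k}` (subset sums = span over `𝔽₂`). [folklore] -/
theorem rescued_iff_notMem_span (i j k : Fin K) :
    d.Rescued i j k ↔ d.off i j k ∉ Submodule.span (ZMod 2) (Set.range (d.slots i j k)) := by
  rw [Submodule.mem_span_range_iff_exists_fun, not_exists]
  refine forall_congr' fun ε => ?_
  rw [← comb_eq_sum, ne_eq, add_eq_zero_iff_eq', eq_comm]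

/-- On the diagonal the offset vanishes: `off(t,t,t) = 0`. [folklore] -/
theorem off_diag (t : Fin K) : d.off t t t = 0 := by
  have e : d.off t t t = (d.xA t + d.xA t) + (d.xB t + d.xB t) + (d.xC t + d.xC t) := by simp only [off]; abel
  rw [e, add_self_eq_zero (d.xA t), add_self_eq_zero (d.xB t), add_self_eq_zero (d.xC t), add_zero, add_zero]

/-- On the diagonal `comb(t,t,t) ε = (ε₀ + ε₁) • sA t + (ε₂ + ε₃) • sB t + (ε₄ + ε₅) • sC t`. [folklore] -/
theorem comb_diag (t : Fin K) (ε : Fin 6 → ZMod 2) :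
    d.comb t t t ε = (ε 0 + ε 1) • d.sA t + (ε 2 + ε 3) • d.sB t + (ε 4 + ε 5) • d.sC t := by
  simp only [comb, add_smul]; abel

/-- If the involutions of triple `t` SPAN `V` and all occur among the slots of `(i, j, k)`, that triple is not rescued.
[folklore] -/
theorem not_rescued_of_range_subset (hV : ∀ t, Submodule.span (ZMod 2) (Set.range (d.basis t)) = ⊤) {i j k t : Fin K}
    (hsub : Set.range (d.basis t) ⊆ Set.range (d.slots i j k)) : ¬ d.Rescued i j k := by
  rw [rescued_iff_notMem_span, not_not]
  exact Submodule.span_mono hsub (by rw [hV t]; trivial)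

omit [AddCommGroup V] [Module (ZMod 2) V] in
/-- Pattern `(t, t, k)`: the slots `(sA t, sA k, sB t, sB t, sC t, sC k)` contain `sA t, sB t, sC t`. [folklore] -/
theorem range_basis_subset_ttk (t k : Fin K) : Set.range (d.basis t) ⊆ Set.range (d.slots t t k) := by
  rintro _ ⟨r, rfl⟩
  fin_cases r
  exacts [⟨0, by simp [basis, slots]⟩, ⟨2, by simp [basis, slots]⟩, ⟨4, by simp [basis, slots]⟩]

omit [AddCommGroup V] [Module (ZMod 2) V] in
/-- Pattern `(i, t, t)`: the slots `(sA i, sA t, sB i, sB t, sC t, sC t)` contain `sA t, sB t, sC t`. [folklore] -/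
theorem range_basis_subset_itt (i t : Fin K) : Set.range (d.basis t) ⊆ Set.range (d.slots i t t) := by
  rintro _ ⟨r, rfl⟩
  fin_cases r
  exacts [⟨1, by simp [basis, slots]⟩, ⟨3, by simp [basis, slots]⟩, ⟨4, by simp [basis, slots]⟩]

omit [AddCommGroup V] [Module (ZMod 2) V] in
/-- Pattern `(t, j, t)`: the slots `(sA t, sA t, sB t, sB j, sC j, sC t)` contain `sA t, sB t, sC t`. [folklore] -/
theorem range_basis_subset_tjt (t j : Fin K) : Set.range (d.basis t) ⊆ Set.range (d.slots t j t) := by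
  rintro _ ⟨r, rfl⟩
  fin_cases r
  exacts [⟨0, by simp [basis, slots]⟩, ⟨2, by simp [basis, slots]⟩, ⟨5, by simp [basis, slots]⟩]

/-- The element of `A t` selected by `ε`: `(xA t + ε • sA t, a t)`. [folklore] -/
def elA (t : Fin K) (ε : ZMod 2) : V × H := (d.xA t + ε • d.sA t, d.a t)

/-- The element of `B t` selected by `ε`: `(xB t + ε • sB t, b t)`. [folklore] -/
def elB (t : Fin K) (ε : ZMod 2) : V × H := (d.xB t + ε • d.sB t, d.b t)

/-- The element of `C t` selected by `ε`: `(xC t + ε • sC t, c t)`. [folklore] -/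
def elC (t : Fin K) (ε : ZMod 2) : V × H := (d.xC t + ε • d.sC t, d.c t)
end VPart

section HPart
variable {V H : Type*} [AddCommGroup H] {K : ℕ} (d : Data V H K)
/-- The `H`-component of the word of `(i, j, k)` — independent of the six chosen elements:
`h(i,j,k) = (a i − a k) + (b j − b i) + (c k − c j)`. [cite: CohnKleinbergSzegedyUmans2005, Def. 5.1] -/
def h (i j k : Fin K) : H := (d.a i - d.a k) + (d.b j - d.b i) + (d.c k - d.c j)

/-- `h(t,t,t) = 0`. [folklore] -/
theorem h_diag (t : Fin K) : d.h t t t = 0 := by simp [h]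
end HPart

section Word
variable {V H : Type*} [AddCommGroup V] [Module (ZMod 2) V] [AddCommGroup H] {K : ℕ} (d : Data V H K)
/-- **The word splits.** With `s' = elA i ε₀`, `s = elA k ε₁`, `t = elB i ε₂`, `t' = elB j ε₃`, `u = elC j ε₄`, `u' = elC k ε₅`:
`(s' − s) + (t' − t) + (u' − u) = (off(i,j,k) + comb(i,j,k) ε, h(i,j,k))`. [cite: CohnKleinbergSzegedyUmans2005, Def. 5.1] -/
theorem word_eq (i j k : Fin K) (ε : Fin 6 → ZMod 2) :
    (d.elA i (ε 0) - d.elA k (ε 1)) + (d.elB j (ε 3) - d.elB i (ε 2)) + (d.elC k (ε 5) - d.elC j (ε 4)) =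
      (d.off i j k + d.comb i j k ε, d.h i j k) := by
  refine Prod.ext ?_ ?_
  · simp only [elA, elB, elC, Prod.fst_add, Prod.fst_sub, off, comb, sub_eq_add']
    abel
  · simp only [elA, elB, elC, Prod.snd_add, Prod.snd_sub, h]
end Word

section Sets
variable {V H : Type*} [AddCommGroup V] [Module (ZMod 2) V] [DecidableEq V] [DecidableEq H] {K : ℕ} (d : Data V H K)
/-- The `A`-sets of the family described by `d`. [cite: CohnKleinbergSzegedyUmans2005, Def. 5.1] -/
def A (t : Fin K) : Finset (V × H) := pair (d.xA t) (d.sA t) (d.a t)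

/-- The `B`-sets of the family described by `d`. [cite: CohnKleinbergSzegedyUmans2005, Def. 5.1] -/
def B (t : Fin K) : Finset (V × H) := pair (d.xB t) (d.sB t) (d.b t)

/-- The `C`-sets of the family described by `d`. [cite: CohnKleinbergSzegedyUmans2005, Def. 5.1] -/
def C (t : Fin K) : Finset (V × H) := pair (d.xC t) (d.sC t) (d.c t)

omit [Module (ZMod 2) V] in
/-- For proper data all sets are 2-sets. [folklore] -/
theorem card_eq_two (hd : d.Proper) (t : Fin K) : (d.A t).card = 2 ∧ (d.B t).card = 2 ∧ (d.C t).card = 2 :=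
  ⟨card_pair _ (hd t).1, card_pair _ (hd t).2.1, card_pair _ (hd t).2.2⟩

/-- `A t = {elA t ε}`, `B t = {elB t ε}`, `C t = {elC t ε}` (`ε ∈ 𝔽₂`). [folklore] -/
theorem mem_iff (t : Fin K) (z : V × H) :
    (z ∈ d.A t ↔ ∃ ε, z = d.elA t ε) ∧ (z ∈ d.B t ↔ ∃ ε, z = d.elB t ε) ∧ (z ∈ d.C t ↔ ∃ ε, z = d.elC t ε) :=
  ⟨mem_pair_iff, mem_pair_iff, mem_pair_iff⟩
end Sets

section Main
variable {V H : Type*} [AddCommGroup V] [Module (ZMod 2) V] [AddCommGroup H] [DecidableEq V] [DecidableEq H] {K : ℕ}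
  (d : Data V H K)
/-- **THE ICOSET CRITERION** (kernel form of the exact reduction of `ICOSET-NOTE.md`, ENG2 gen 27).  For proper data in
`V × H` (`V` a `ZMod 2`-module, `H` any abelian group) the family `(A t, B t, C t)_{t<K}` satisfies CKSU Def. 5.1 iff
(T) every `(sA t, sB t, sC t)` is `𝔽₂`-independent and (N) every non-constant index triple with
`h(i,j,k) = (a i − a k) + (b j − b i) + (c k − c j) = 0` is RESCUED (`off ∉ span{slots}`, `rescued_iff_notMem_span`).
[cite: CohnKleinbergSzegedyUmans2005, Def. 5.1] -/
theorem isSTPP_iff (hd : d.Proper) :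
    IsSTPP d.A d.B d.C ↔
      (∀ t, d.Indep t) ∧ ∀ i j k : Fin K, ¬ (i = j ∧ j = k) → d.h i j k = 0 → d.Rescued i j k := by
  constructor
  · intro hS
    refine ⟨fun t ε₁ ε₂ ε₃ h0 => ?_, fun i j k hne hh ε hε => ?_⟩
    · -- (T): the word of `(t,t,t)` with choice vector `(ε₁, 0, 0, ε₂, 0, ε₃)`
      have hw := d.word_eq t t t ![ε₁, 0, 0, ε₂, 0, ε₃]
      have hc : d.comb t t t ![ε₁, 0, 0, ε₂, 0, ε₃] = ε₁ • d.sA t + ε₂ • d.sB t + ε₃ • d.sC t := by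
        simp [comb]
      rw [hc, d.off_diag, d.h_diag, zero_add, h0] at hw
      obtain ⟨-, -, h1, h2, h3⟩ := hS t t t _ ((d.mem_iff t _).1.2 ⟨_, rfl⟩) _ ((d.mem_iff t _).1.2 ⟨_, rfl⟩)
        _ ((d.mem_iff t _).2.1.2 ⟨_, rfl⟩) _ ((d.mem_iff t _).2.1.2 ⟨_, rfl⟩) _ ((d.mem_iff t _).2.2.2 ⟨_, rfl⟩)
        _ ((d.mem_iff t _).2.2.2 ⟨_, rfl⟩) (hw.trans rfl)
      simp only [elA, elB, elC, Prod.mk.injEq, and_true, Matrix.cons_val_zero, Matrix.cons_val_one,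
        Matrix.cons_val, zero_smul, add_zero] at h1 h2 h3
      refine ⟨(smul_eq_zero_iff_left (hd t).1 ε₁).1 ?_, (smul_eq_zero_iff_left (hd t).2.1 ε₂).1 ?_,
        (smul_eq_zero_iff_left (hd t).2.2 ε₃).1 ?_⟩
      · simpa using congrArg (fun v => v - d.xA t) h1.symm
      · simpa using congrArg (fun v => v - d.xB t) h2.symm
      · simpa using congrArg (fun v => v - d.xC t) h3.symm
    · -- (N): an unrescued non-constant zero triple contradicts simultaneity
      have hw := d.word_eq i j k ε
      rw [hε, hh] at hw
      obtain ⟨hij, hjk, -⟩ := hS i j k _ ((d.mem_iff k _).1.2 ⟨_, rfl⟩) _ ((d.mem_iff i _).1.2 ⟨_, rfl⟩)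
        _ ((d.mem_iff i _).2.1.2 ⟨_, rfl⟩) _ ((d.mem_iff j _).2.1.2 ⟨_, rfl⟩) _ ((d.mem_iff j _).2.2.2 ⟨_, rfl⟩)
        _ ((d.mem_iff k _).2.2.2 ⟨_, rfl⟩) (hw.trans rfl)
      exact hne ⟨hij, hjk⟩
  · rintro ⟨hT, hN⟩ i j k s hs s' hs' t ht t' ht' u hu u' hu' h0
    obtain ⟨ε₁, rfl⟩ := ((d.mem_iff k s).1).1 hs
    obtain ⟨ε₀, rfl⟩ := ((d.mem_iff i s').1).1 hs'
    obtain ⟨ε₂, rfl⟩ := ((d.mem_iff i t).2.1).1 ht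
    obtain ⟨ε₃, rfl⟩ := ((d.mem_iff j t').2.1).1 ht'
    obtain ⟨ε₄, rfl⟩ := ((d.mem_iff j u).2.2).1 hu
    obtain ⟨ε₅, rfl⟩ := ((d.mem_iff k u').2.2).1 hu'
    have hw := d.word_eq i j k ![ε₀, ε₁, ε₂, ε₃, ε₄, ε₅]
    simp only [Matrix.cons_val_zero, Matrix.cons_val_one, Matrix.cons_val] at hw
    rw [h0] at hw
    have hV : d.off i j k + d.comb i j k ![ε₀, ε₁, ε₂, ε₃, ε₄, ε₅] = 0 := (congrArg Prod.fst hw).symm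
    have hH : d.h i j k = 0 := (congrArg Prod.snd hw).symm
    by_cases hdiag : i = j ∧ j = k
    · obtain ⟨rfl, rfl⟩ := hdiag
      rw [d.off_diag, zero_add, d.comb_diag] at hV
      simp only [Matrix.cons_val_zero, Matrix.cons_val_one, Matrix.cons_val] at hV
      obtain ⟨h01, h23, h45⟩ := hT i _ _ _ hV
      rw [zmod2_add_eq_zero_iff] at h01 h23 h45
      exact ⟨rfl, rfl, by rw [h01], by rw [h23], by rw [h45]⟩
    · exact absurd hV (hN i j k hdiag hH _)

/-- **(D) at 2-rank exactly three.** If every triple's involutions span `V`, an STPP icoset family has `c − a`, `b − a`, `b − c`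
INJECTIVE on `Fin K`: the `H`-parts of the words of `(t,t,k)`, `(i,t,t)`, `(t,j,t)` are `−((c t − a t) − (c k − a k))`,
`−((b i − a i) − (b t − a t))`, `−((b t − c t) − (b j − c j))`, and these triples are never rescued. [cite: CohnKleinbergSzegedyUmans2005, Def. 5.1] -/
theorem injective_of_isSTPP (hd : d.Proper) (hV : ∀ t, Submodule.span (ZMod 2) (Set.range (d.basis t)) = ⊤)
    (hS : IsSTPP d.A d.B d.C) :
    Function.Injective (fun t => d.c t - d.a t) ∧ Function.Injective (fun t => d.b t - d.a t) ∧
      Function.Injective (fun t => d.b t - d.c t) := by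
  obtain ⟨-, hN⟩ := (d.isSTPP_iff hd).1 hS
  refine ⟨fun t k htk => ?_, fun i t hit => ?_, fun t j htj => ?_⟩
  · by_contra hne
    refine d.not_rescued_of_range_subset hV (d.range_basis_subset_ttk t k) (hN t t k (fun h => hne h.2) ?_)
    simp only [h] at htk ⊢
    rw [← sub_eq_zero] at htk
    rw [← neg_eq_zero, ← htk]; abel
  · by_contra hne
    refine d.not_rescued_of_range_subset hV (d.range_basis_subset_itt i t) (hN i t t (fun h => hne h.1) ?_)
    simp only [h] at hit ⊢
    rw [← sub_eq_zero] at hit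
    rw [← neg_eq_zero, ← hit]; abel
  · by_contra hne
    refine d.not_rescued_of_range_subset hV (d.range_basis_subset_tjt t j) (hN t j t (fun h => hne h.1) ?_)
    simp only [h] at htj ⊢
    rw [← sub_eq_zero] at htj
    rw [← neg_eq_zero, ← htj]; abel

/-- **The (T)(D)(Z) form at 2-rank exactly three** (`ICOSET-NOTE.md` '## Exact reduction'): if every triple's involutions span
`V`, the icoset family is STPP iff (T) each `(sA t, sB t, sC t)` is independent, (D) `c − a`, `b − a`, `b − c` are injective,
and (Z) every PAIRWISE-DISTINCT `(i, j, k)` with `h(i,j,k) = 0` is rescued. [cite: CohnKleinbergSzegedyUmans2005, Def. 5.1] -/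
theorem isSTPP_iff_of_span_eq_top (hd : d.Proper) (hV : ∀ t, Submodule.span (ZMod 2) (Set.range (d.basis t)) = ⊤) :
    IsSTPP d.A d.B d.C ↔
      (∀ t, d.Indep t) ∧
      (Function.Injective (fun t => d.c t - d.a t) ∧ Function.Injective (fun t => d.b t - d.a t) ∧
        Function.Injective (fun t => d.b t - d.c t)) ∧
      ∀ i j k : Fin K, i ≠ j → j ≠ k → i ≠ k → d.h i j k = 0 → d.Rescued i j k := by
  constructor
  · intro hS
    obtain ⟨hT, hN⟩ := (d.isSTPP_iff hd).1 hS
    exact ⟨hT, d.injective_of_isSTPP hd hV hS, fun i j k hij _ _ => hN i j k (fun h => hij h.1)⟩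
  · rintro ⟨hT, ⟨hca, hba, hbc⟩, hZ⟩
    refine (d.isSTPP_iff hd).2 ⟨hT, fun i j k hne hh => ?_⟩
    simp only [h] at hh
    by_cases hij : i = j
    · subst hij
      have hik : i ≠ k := fun e => hne ⟨rfl, e⟩
      refine absurd (hca ?_).symm hik
      show d.c k - d.a k = d.c i - d.a i
      rw [← sub_eq_zero, ← hh]; abel
    by_cases hjk : j = k
    · subst hjk
      refine absurd (hba ?_).symm hij
      show d.b j - d.a j = d.b i - d.a i
      rw [← sub_eq_zero, ← hh]; abel
    by_cases hik : i = k
    · subst hik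
      refine absurd (hbc ?_).symm hij
      show d.b j - d.c j = d.b i - d.c i
      rw [← sub_eq_zero, ← hh]; abel
    exact hZ i j k hij hjk hik hh
end Main

end Data

section Class
variable {V H : Type*} [AddCommGroup V] [DecidableEq V] [DecidableEq H]
/-- A family of finsets in `V × H` is an INVOLUTION-COSET family if every set is `pair x s a = {(x, a), (x + s, a)}` with `s ≠ 0`.
[cite: CohnKleinbergSzegedyUmans2005, Def. 5.1] -/
def IsIcosetFamily {K : ℕ} (A B C : Fin K → Finset (V × H)) : Prop :=
  ∀ t, (∃ x s a, s ≠ 0 ∧ A t = pair x s a) ∧ (∃ x s a, s ≠ 0 ∧ B t = pair x s a) ∧ (∃ x s a, s ≠ 0 ∧ C t = pair x s a)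

/-- The family of proper data is an icoset family. [folklore] -/
theorem Data.isIcosetFamily {K : ℕ} (d : Data V H K) (hd : d.Proper) : IsIcosetFamily d.A d.B d.C :=
  fun t => ⟨⟨_, _, _, (hd t).1, rfl⟩, ⟨_, _, _, (hd t).2.1, rfl⟩, ⟨_, _, _, (hd t).2.2, rfl⟩⟩

/-- Every icoset family IS the family of some proper data. [folklore] -/
theorem exists_data_of_isIcosetFamily {K : ℕ} {A B C : Fin K → Finset (V × H)} (hF : IsIcosetFamily A B C) :
    ∃ d : Data V H K, d.Proper ∧ d.A = A ∧ d.B = B ∧ d.C = C := by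
  choose xA sA a hsA hA using fun t => (hF t).1
  choose xB sB b hsB hB using fun t => (hF t).2.1
  choose xC sC c hsC hC using fun t => (hF t).2.2
  exact ⟨⟨xA, xB, xC, sA, sB, sC, a, b, c⟩, fun t => ⟨hsA t, hsB t, hsC t⟩, funext fun t => (hA t).symm,
    funext fun t => (hB t).symm, funext fun t => (hC t).symm⟩

variable [Module (ZMod 2) V] [AddCommGroup H]
/-- **Class form of the criterion.** An icoset `(2,2,2)^K` STPP family exists in `V × H` iff some proper data satisfies
(T) ∧ (N). [cite: CohnKleinbergSzegedyUmans2005, Def. 5.1] -/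
theorem exists_isIcosetFamily_isSTPP_iff (K : ℕ) :
    (∃ A B C : Fin K → Finset (V × H), IsIcosetFamily A B C ∧ IsSTPP A B C) ↔
      ∃ d : Data V H K, d.Proper ∧ (∀ t, d.Indep t) ∧
        ∀ i j k : Fin K, ¬ (i = j ∧ j = k) → d.h i j k = 0 → d.Rescued i j k := by
  constructor
  · rintro ⟨A, B, C, hF, hS⟩
    obtain ⟨d, hd, rfl, rfl, rfl⟩ := exists_data_of_isIcosetFamily hF
    exact ⟨d, hd, (d.isSTPP_iff hd).1 hS⟩
  · rintro ⟨d, hd, hTN⟩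
    exact ⟨d.A, d.B, d.C, d.isIcosetFamily hd, (d.isSTPP_iff hd).2 hTN⟩
end Class

end Icoset

end Summit.MatrixMultiplication.OmegaCensus
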